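import Summits.AtomisticToContinuum.HydrodynamicLimit.Theorems.PolynomialCompression.Negative.PdeForm
import Summits.AtomisticToContinuum.HydrodynamicLimit.Theorems.PolynomialCompression.Negative.Statics
import Summits.AtomisticToContinuum.HydrodynamicLimit.Theorems.PolynomialCompression.Negative.Energy

/-!
# σ-uniform mass, density and energy budgets of every admissible classical solution

Negative-side structure (tightness of witnesses) for the crux `ImplosionDichotomy.PolynomialCompression`
(stmt-AtomisticToContinuum-12587), from the standing disprover's `Cruxes/PolynomialCompression/Disproof.lean` §7/§10
(cycle 3), combining the landed `Negative/PdeForm.lean` (data pinning), `Negative/Statics.lean` (unit mass of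
`rhoLim`), `DenseExcursionAtTimeZero.rhoLim_lt` (`rhoLim < (2e+1)M`) and `Negative/Energy.lean` (energy conservation):
below the statics threshold `σ₁(a₀, θ₀, u₀)`, EVERY admissible classical hard-sphere-Euler solution with `0 < T` has
* `∫ ρ(0) = 1` and `ρ(0) < (2e+1)·M` pointwise (`admissible_density_zero_bounds`; `M = sup a₀/∫a₀`);
* initial total energy `∫ E(0) ≤ (2e+1)·M·(B_u²/2 + (3/2)B_θ)` for any sup bounds `‖u₀‖ ≤ B_u`, `θ₀ ≤ B_θ`
  (`admissible_energy_zero_le`) — a constant of the PROFILES, independent of `σ`;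
* hence, if its pressure field is smooth (automatic once `HsEosLowDensity`, stmt-0768, lands), kinetic and internal
  energy stay below that constant at ALL times (`admissible_energy_budget`).
So a witness of the crux compresses to density `σ^(-κ) → ∞` at unit mass and σ-uniformly bounded energy: the
compression is a CONCENTRATION (volume `≤ σ^κ`, `Negative/Everywhere.lean`) fed by focusing, exactly as in the
intended self-similar implosion. refuter-cdisprove-stmt-AtomisticToContinuum-12587-g3-0.
-/

noncomputable section

namespace Summit.AtomisticToContinuum.HydrodynamicLimit.Theorems

namespace PolynomialCompressionBudget

open MeasureTheory Filter Set Topology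
open Literature.MathematicalPhysics.KineticTheory Literature.Analysis.FluidPDE
open Literature.Analysis.FunctionSpaces
open PolynomialCompressionPDE (Flows admissible_iff_data continuous_slices_zero)
open PolynomialCompressionStatics (integral_rhoLim_eq_one)
open DenseExcursionAtTimeZero (rhoLim_lt)
open PolynomialCompressionEnergy (energy_budget)

/-- **Unit mass and σ-uniform sup bound of admissible data**: below the statics threshold, every admissible
classical solution with `0 < T` has `∫ ρ(0) = 1` and `ρ(0) < (2e+1)·M`. [folklore] -/
theorem admissible_density_zero_bounds {a₀ θ₀ : T3 → ℝ} {u₀ : T3 → V3} (ha : Continuous a₀) (hθ : Continuous θ₀)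
    (hu : Continuous u₀) (ha0 : ∀ x, 0 < a₀ x) (hθ0 : ∀ x, 0 < θ₀ x) :
    ∃ σ₁ : ℝ, 0 < σ₁ ∧ ∀ σ : ℝ, 0 < σ → σ < σ₁ → ∀ (T : ℝ) (ρ θ : ℝ → T3 → ℝ) (u : ℝ → T3 → V3),
      IsHardSphereEulerSolution σ T ρ u θ →
        (∀ Φ : Flows σ, TendstoHydroFieldsAt (fun N => localGibbsLaw σ a₀ u₀ θ₀ N (Φ N)) Φ ρ u θ 0) → 0 < T →
          ∫ y, ρ 0 y = 1 ∧ ∀ y, ρ 0 y < (2 * Real.exp 1 + 1) * (profileOf a₀ ha ha0).M := by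
  obtain ⟨σ₁, hσ₁, -, G⟩ := admissible_iff_data ha hθ hu ha0 hθ0
  refine ⟨σ₁, hσ₁, fun σ hσ hσlt T ρ θ u hE hA hT => ?_⟩
  obtain ⟨h, G'⟩ := G σ hσ hσlt
  obtain ⟨hρc, huc, hθc⟩ := continuous_slices_zero hE hT
  obtain ⟨hρ0, -, -⟩ := (G' ρ θ u hρc huc hθc).1 hA
  rw [hρ0]
  exact ⟨integral_rhoLim_eq_one h, fun y => rhoLim_lt h y⟩

/-- **σ-uniform bound on the initial total energy of admissible data**: with sup bounds `‖u₀‖ ≤ B_u`, `θ₀ ≤ B_θ`,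
below the statics threshold every admissible classical solution with `0 < T` has
`∫ E(0) ≤ (2e+1)·M·(B_u²/2 + (3/2)B_θ)` (data pinning: `E(0) = rhoLim·(|u₀|²/2 + 3θ₀/2)`). [folklore] -/
theorem admissible_energy_zero_le {a₀ θ₀ : T3 → ℝ} {u₀ : T3 → V3} (ha : Continuous a₀) (hθ : Continuous θ₀)
    (hu : Continuous u₀) (ha0 : ∀ x, 0 < a₀ x) (hθ0 : ∀ x, 0 < θ₀ x) {Bu Bθ : ℝ} (hBu : ∀ x, ‖u₀ x‖ ≤ Bu)
    (hBθ : ∀ x, θ₀ x ≤ Bθ) :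
    ∃ σ₁ : ℝ, 0 < σ₁ ∧ ∀ σ : ℝ, 0 < σ → σ < σ₁ → ∀ (T : ℝ) (ρ θ : ℝ → T3 → ℝ) (u : ℝ → T3 → V3),
      IsHardSphereEulerSolution σ T ρ u θ →
        (∀ Φ : Flows σ, TendstoHydroFieldsAt (fun N => localGibbsLaw σ a₀ u₀ θ₀ N (Φ N)) Φ ρ u θ 0) → 0 < T →
          ∫ y, totalEnergyDensity (ρ 0 y) (u 0 y) (θ 0 y) ≤
            (2 * Real.exp 1 + 1) * (profileOf a₀ ha ha0).M * (Bu ^ 2 / 2 + 3 / 2 * Bθ) := by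
  obtain ⟨σ₁, hσ₁, -, G⟩ := admissible_iff_data ha hθ hu ha0 hθ0
  refine ⟨σ₁, hσ₁, fun σ hσ hσlt T ρ θ u hE hA hT => ?_⟩
  obtain ⟨h, G'⟩ := G σ hσ hσlt
  obtain ⟨hρc, huc, hθc⟩ := continuous_slices_zero hE hT
  obtain ⟨hρ0, hu0, hθ0'⟩ := (G' ρ θ u hρc huc hθc).1 hA
  set K := (2 * Real.exp 1 + 1) * (profileOf a₀ ha ha0).M with hK
  have h0 : (0 : ℝ) ∈ Ico 0 T := ⟨le_rfl, hT⟩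
  have hpt : ∀ y, totalEnergyDensity (ρ 0 y) (u 0 y) (θ 0 y) ≤ K * (Bu ^ 2 / 2 + 3 / 2 * Bθ) := by
    intro y
    have hρlt : ρ 0 y < K := by rw [hρ0]; exact rhoLim_lt h y
    have hρnn : 0 ≤ ρ 0 y := (hE.density_pos 0 h0 y).le
    have hin : ‖u 0 y‖ ^ 2 / 2 + 3 / 2 * θ 0 y ≤ Bu ^ 2 / 2 + 3 / 2 * Bθ := by
      rw [hu0, hθ0']
      have h1 : ‖u₀ y‖ ^ 2 ≤ Bu ^ 2 := pow_le_pow_left₀ (norm_nonneg _) (hBu y) 2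
      have h2 := hBθ y
      linarith
    have hin0 : 0 ≤ ‖u 0 y‖ ^ 2 / 2 + 3 / 2 * θ 0 y := by
      have := (hE.temperature_pos 0 h0 y).le
      positivity
    unfold totalEnergyDensity
    exact mul_le_mul hρlt.le hin hin0 (hρnn.trans hρlt.le)
  have hint : Integrable (fun y => totalEnergyDensity (ρ 0 y) (u 0 y) (θ 0 y)) volume := by
    refine integrable_of_continuous_T3 ?_
    unfold totalEnergyDensity
    exact hρc.mul (((huc.norm.pow 2).div_const 2).add (continuous_const.mul hθc))
  calc ∫ y, totalEnergyDensity (ρ 0 y) (u 0 y) (θ 0 y)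
      ≤ ∫ _y : T3, K * (Bu ^ 2 / 2 + 3 / 2 * Bθ) := integral_mono hint (integrable_const _) hpt
    _ = K * (Bu ^ 2 / 2 + 3 / 2 * Bθ) := by
        rw [integral_const, smul_eq_mul, probReal_univ, one_mul]

/-- **σ-UNIFORM ENERGY BUDGET AT ALL TIMES**: below the statics threshold, along every admissible classical solution
whose pressure field is jointly smooth, the kinetic energy `∫ ρ|u|²/2` and the internal energy `∫ (3/2)ρθ` are each
`≤ (2e+1)·M·(B_u²/2 + (3/2)B_θ)` at every `t ∈ [0,T)` — a constant of the profiles (`‖u₀‖ ≤ B_u`, `θ₀ ≤ B_θ`),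
independent of `σ`. [folklore] -/
theorem admissible_energy_budget {a₀ θ₀ : T3 → ℝ} {u₀ : T3 → V3} (ha : Continuous a₀) (hθ : Continuous θ₀)
    (hu : Continuous u₀) (ha0 : ∀ x, 0 < a₀ x) (hθ0 : ∀ x, 0 < θ₀ x) {Bu Bθ : ℝ} (hBu : ∀ x, ‖u₀ x‖ ≤ Bu)
    (hBθ : ∀ x, θ₀ x ≤ Bθ) :
    ∃ σ₁ : ℝ, 0 < σ₁ ∧ ∀ σ : ℝ, 0 < σ → σ < σ₁ → ∀ (T : ℝ) (ρ θ : ℝ → T3 → ℝ) (u : ℝ → T3 → V3),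
      IsHardSphereEulerSolution σ T ρ u θ →
        Torus.IsSmoothSpaceTimeOn (Ico 0 T) (fun t y => hsPressure σ (ρ t y) (θ t y)) →
        (∀ Φ : Flows σ, TendstoHydroFieldsAt (fun N => localGibbsLaw σ a₀ u₀ θ₀ N (Φ N)) Φ ρ u θ 0) →
          ∀ t ∈ Ico 0 T,
            ∫ x, ρ t x * (‖u t x‖ ^ 2 / 2) ≤ (2 * Real.exp 1 + 1) * (profileOf a₀ ha ha0).M * (Bu ^ 2 / 2 + 3 / 2 * Bθ) ∧
            ∫ x, ρ t x * (3 / 2 * θ t x) ≤ (2 * Real.exp 1 + 1) * (profileOf a₀ ha ha0).M * (Bu ^ 2 / 2 + 3 / 2 * Bθ) := by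
  obtain ⟨σ₁, hσ₁, G⟩ := admissible_energy_zero_le ha hθ hu ha0 hθ0 hBu hBθ
  refine ⟨σ₁, hσ₁, fun σ hσ hσlt T ρ θ u hE hp hA t ht => ?_⟩
  have hE0 := G σ hσ hσlt T ρ θ u hE hA (ht.1.trans_lt ht.2)
  obtain ⟨hK, hI⟩ := energy_budget hE hp ht
  exact ⟨hK.trans hE0, hI.trans hE0⟩

end PolynomialCompressionBudget

end Summit.AtomisticToContinuum.HydrodynamicLimit.Theorems

end
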